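import Summits.NavierStokesRegularity.NavierStokesRegularity.Theorems.AxisTwistDoorAveragedConeLiouvilleUnitContraction
import Summits.NavierStokesRegularity.NavierStokesRegularity.Theorems.AxisTwistDoorAveragedConeLiouvillePositivityAffine
import Summits.NavierStokesRegularity.NavierStokesRegularity.Theorems.AxisTwistDoorAveragedConeLiouvilleHarnackChainCore
import Summits.NavierStokesRegularity.NavierStokesRegularity.Theorems.AxisTwistDoorAveragedConeLiouvilleHarnackChainData
import Summits.NavierStokesRegularity.NavierStokesRegularity.Theorems.AxisTwistDoorAveragedConeLiouvilleShellBookkeeping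
import HarnessLib

/-!
# Route `AxisTwistDoor`, crux `AveragedConeLiouville` (stmt-NavierStokesRegularity-26889), line `lrt_shell` v6:
# stub (5b-ii) — the PURE-PDE HARNACK CHAIN `AxisHarnackChain(A)` (proof; the by-name stub file is `…HarnackChainA`)

Lei–Ren–Tian, arXiv:2501.08976, §4 pp. 11–12 (the positivity-propagation passage for `V = M − Γ`, made uniform; card
`Cruxes/AveragedConeLiouville/Lines/lrt_shell.md` §Chain plan).  GIVEN the positivity propagation on affine cylinders
(`PositivityPropagationAffineC`, brick H2, from the classical Nazarov–Ural'tseva fact), for constants `δ₀ > 0`,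
`C_d, A ≥ 0`, `κ₀ > 0` there is `c = c(δ₀, C_d, A, κ₀) > 0` such that every `Γ` with `AxisCirculationData Γ δ₀ C_d A Γ*`,
the level `κ₀` met in every `𝒬(ρ)` and `Γ ≤ M` on `𝒬(9/10)` satisfies `Γ ≤ M − c` on `𝒬(9/20)`.

Proof (one chain per target point `(s₁, r₁, z₁) ∈ 𝒬(9/20)`): `M ≥ κ₀`; `V = M − Γ̂ ≥ 0` is a classical supersolution with
the divergence-free radial drift `((2−C_d)/r) e_r` on the off-axis region (brick B1′), wherever eq. Gamma-34 holds;
with `r_* = min(κ₀/(4A+4), 1/2)`, `ρ = min(r_*/4, δ₀/2, 1/20)`, cylinders of radius `ρ`, time-shape `T = 1`, half-step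
`L = ρ²/2`, centres `cylPt (min a (5r_*/8 + kρ/2)) 0 z₁` on one ray at height `z₁` and start time `t₀ ∈ [−(a+δ)², −(a+δ)²+L)`
chosen so that the last conclusion window `(t_N + L, t_N + 2L)` contains `s₁` and ends before `0`:
the first cylinders sit in the early slab (where `Γ ≤ 2A r ≤ κ₀/2` near the axis gives `V ≥ κ₀/2` on the whole first
ball), the later ones on the lateral shell `{|r − a| < δ}`; the abstract chain (brick B2/B3 `chain_positivity`) yields
`V(s₁, cylPt a 0 z₁) ≥ β^{N+1} κ₀/2 ≥ β^{N_max+1} κ₀/2 =: c` (`N ≤ N_max = ⌊1/L⌋ + 1`), and monotonicity in `r`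
(`r₁ < 9/20 < a`) gives `Γ(r₁,z₁,s₁) ≤ Γ(a,z₁,s₁) = M − V ≤ M − c`.

* `axisHarnackChain_of_affine : PositivityPropagationAffineC → …` (the chain itself);
* `axisHarnackChain : AxisHarnackChain` (the `…UnitContraction` text, via `positivityPropagationAffine_of_factC`);
  the registered stub `stub_axisHarnackChainA : AxisHarnackChainA` (`…HarnackDefs`) is the one-liner
  `axisHarnackChain_of_affine` and lands in its own file.

Width seat ns-in-wu-341 g2 under LEAD ns-atd-p1. [cite: LeiRenTian2025, §4 (arXiv:2501.08976, pp. 11–12);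
NazarovUraltseva2011HarnackDivFree, Cor. 3.2]

WHAT THIS IS NOT: not a statement about Navier–Stokes regularity; a pure-PDE lemma for a STAGED door route whose
positivity-propagation input is the NAMED (unproved in tree) Nazarov–Ural'tseva fact; `AveragedConeLiouville`, item 26889
and the summit remain OPEN.
-/

noncomputable section

-- the summit and its single sub-problem share the name (CONVENTIONS §1)
set_option linter.dupNamespace false

namespace Summit.NavierStokesRegularity.NavierStokesRegularity.Theorems.AveragedConeLiouville.HarnackChain

open scoped InnerProductSpace Laplacian Topology ENNReal
open Set Function Filter Metric MeasureTheory
open Literature.Analysis Literature.Analysis.FluidPDE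
open Summit.NavierStokesRegularity.NavierStokesRegularity.Theorems.AxisTwistDoorAveragedConeLiouvilleDefs
open Summit.NavierStokesRegularity.NavierStokesRegularity.Theorems.AxisTwistDoorAveragedConeLiouvilleUnitContraction
open Summit.NavierStokesRegularity.NavierStokesRegularity.Theorems.AxisTwistDoorAveragedConeLiouvillePositivityAffine
open Summit.NavierStokesRegularity.NavierStokesRegularity.Theorems.AxisTwistDoorAveragedConeLiouvilleAxisLift
open Summit.NavierStokesRegularity.NavierStokesRegularity.Theorems.AveragedConeLiouville

/-! ### Geometry of the centres on one ray -/

/-- The third coordinate of `cylPt r θ z` is `z`. [folklore] -/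
theorem cylPt_apply_two (r θ z : ℝ) : cylPt r θ z 2 = z := (ShellBookkeeping.cylPt_apply r θ z).2.2

/-- Two points on the ray `θ = 0` at the same height are `|r₁ − r₂|` apart. [folklore] -/
theorem dist_cylPt_ray (r₁ r₂ z : ℝ) : dist (cylPt r₁ 0 z) (cylPt r₂ 0 z) = |r₁ - r₂| := by
  rw [dist_eq_norm, EuclideanSpace.norm_eq, Fin.sum_univ_three]
  obtain ⟨h0, h1, h2⟩ := ShellBookkeeping.cylPt_apply r₁ 0 z
  obtain ⟨k0, k1, k2⟩ := ShellBookkeeping.cylPt_apply r₂ 0 z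
  simp only [PiLp.sub_apply, h0, h1, h2, k0, k1, k2, Real.cos_zero, Real.sin_zero, mul_one, mul_zero, sub_self,
    Real.norm_eq_abs, sq_abs]
  rw [show (r₁ - r₂) ^ 2 + (0 : ℝ) ^ 2 + (0 : ℝ) ^ 2 = (r₁ - r₂) ^ 2 by ring, Real.sqrt_sq_eq_abs]

/-- In the ball `B(cylPt r 0 z, ρ)` (`r ≥ 0`): `r − ρ < |y_h| < r + ρ` and `|y₃| < |z| + ρ`. [folklore] -/
theorem ball_cylPt_bounds {r z ρ : ℝ} (hr : 0 ≤ r) {y : EuclideanSpace ℝ (Fin 3)} (hy : dist y (cylPt r 0 z) ≤ ρ) :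
    r - ρ ≤ cylRadius y ∧ cylRadius y ≤ r + ρ ∧ |y 2| ≤ |z| + ρ := by
  have h1 := HarnackChainData.cylRadius_le_cylRadius_add_dist y (cylPt r 0 z)
  have h2 := HarnackChainData.cylRadius_le_cylRadius_add_dist (cylPt r 0 z) y
  rw [ShellBookkeeping.cylRadius_cylPt hr] at h1 h2
  rw [dist_comm] at h2
  refine ⟨by linarith, by linarith, ?_⟩
  have h3 : |y 2 - z| ≤ dist y (cylPt r 0 z) := by
    have := PiLp.norm_apply_le (y - cylPt r 0 z) 2
    rwa [PiLp.sub_apply, cylPt_apply_two, Real.norm_eq_abs, ← dist_eq_norm] at this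
  have h4 : |y 2| ≤ |y 2 - z| + |z| := by
    have := abs_add_le (y 2 - z) z; simpa using this
  linarith

/-! ### The chain -/

set_option maxHeartbeats 1000000 in
-- one long bookkeeping proof (≈ 60 local facts feeding `linarith`); splitting it would only move the heartbeats
/-- **The Harnack chain from the affine positivity propagation** (module docstring).
[cite: LeiRenTian2025, §4 (arXiv:2501.08976, pp. 11–12)] -/
theorem axisHarnackChain_of_affine (hAff : PositivityPropagationAffineC) :
    ∀ (δ₀ Cd A κ₀ : ℝ), 0 < δ₀ → 0 ≤ Cd → 0 ≤ A → 0 < κ₀ →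
    ∃ c : ℝ, 0 < c ∧ ∀ (Γ : ℝ → ℝ → ℝ → ℝ) (Γstar M : ℝ), AxisCirculationData Γ δ₀ Cd A Γstar →
      (∀ ρ : ℝ, 0 < ρ → ∃ s r z : ℝ, -ρ ^ 2 < s ∧ s < 0 ∧ 0 < r ∧ r < ρ ∧ |z| < ρ ∧ κ₀ ≤ Γ r z s) →
      (∀ s r z : ℝ, -(9 / 10) ^ 2 < s → s < 0 → 0 < r → r < 9 / 10 → |z| < 9 / 10 → Γ r z s ≤ M) →
      ∀ s r z : ℝ, -(9 / 20) ^ 2 < s → s < 0 → 0 < r → r < 9 / 20 → |z| < 9 / 20 → Γ r z s ≤ M - c := by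
  intro δ₀ Cd A κ₀ hδ₀ hCd hA hκ₀
  -- ### constants
  set rstar : ℝ := min (κ₀ / (4 * A + 4)) (1 / 2) with hrstar
  have h4A : 0 < 4 * A + 4 := by positivity
  have hrstar0 : 0 < rstar := lt_min (div_pos hκ₀ h4A) (by norm_num)
  have hrstar2 : rstar ≤ 1 / 2 := min_le_right _ _
  have hrstarA : 2 * A * rstar ≤ κ₀ / 2 := by
    have h1 : rstar ≤ κ₀ / (4 * A + 4) := min_le_left _ _
    have h2 : 2 * A * rstar ≤ 2 * A * (κ₀ / (4 * A + 4)) := mul_le_mul_of_nonneg_left h1 (by positivity)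
    have h3 : 2 * A / (4 * A + 4) ≤ 1 / 2 := by
      rw [div_le_iff₀ h4A]; linarith
    have h4 : 2 * A * (κ₀ / (4 * A + 4)) = κ₀ * (2 * A / (4 * A + 4)) := by ring
    have h5 : κ₀ * (2 * A / (4 * A + 4)) ≤ κ₀ * (1 / 2) := mul_le_mul_of_nonneg_left h3 hκ₀.le
    linarith
  set ρ : ℝ := min (rstar / 4) (min (δ₀ / 2) (1 / 20)) with hρdef
  have hρ0 : 0 < ρ := lt_min (by positivity) (lt_min (by positivity) (by norm_num))
  have hρr : ρ ≤ rstar / 4 := min_le_left _ _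
  have hρδ : ρ ≤ δ₀ / 2 := (min_le_right _ _).trans (min_le_left _ _)
  have hρ20 : ρ ≤ 1 / 20 := (min_le_right _ _).trans (min_le_right _ _)
  set L : ℝ := ρ ^ 2 * 1 / 2 with hLdef
  have hL0 : 0 < L := by positivity
  set Λ : ℝ := ρ * (|2 - Cd| / (rstar / 4)) with hΛdef
  have hΛ0 : 0 ≤ Λ := by positivity
  obtain ⟨β, hβ, hβ1, hchain⟩ := HarnackChainCore.chain_positivity hAff one_pos hΛ0
  obtain ⟨Nmax, hNmax⟩ : ∃ Nmax : ℕ, 1 / L ≤ Nmax := exists_nat_ge (1 / L)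
  refine ⟨β ^ (Nmax + 1) * (κ₀ / 2), by positivity, ?_⟩
  intro Γ Γstar M hdata hlev hbound s₁ r₁ z₁ hs₁ hs₁0 hr₁ hr₁' hz₁
  obtain ⟨hC2, hmono, -, hsmall, a, δ, ha1, ha2, hδ1, hδ2, h34⟩ := hdata
  have hδ0 : 0 < δ := hδ₀.trans_le hδ1
  have ha0 : 0 ≤ a := by linarith
  have haδ9 : a + δ < 9 / 10 := by linarith
  -- ### `M ≥ κ₀`
  have hMκ : κ₀ ≤ M := by
    obtain ⟨s, r, z, hs, hs0, hr, hr', hz, hκ⟩ := hlev (9 / 20) (by norm_num)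
    exact hκ.trans (hbound s r z (by linarith) hs0 hr (by linarith) (by linarith))
  -- ### the time parameters of the chain for the target time `s₁`
  set e : ℝ := (s₁ + min 0 (s₁ + L)) / 2 with hedef
  have he1 : s₁ < e := by
    have : s₁ < min 0 (s₁ + L) := lt_min hs₁0 (by linarith)
    rw [hedef]; linarith
  have he2 : e < 0 := by
    have : min 0 (s₁ + L) ≤ 0 := min_le_left _ _
    rw [hedef]; linarith
  have he3 : e < s₁ + L := by
    have : min 0 (s₁ + L) ≤ s₁ + L := min_le_right _ _
    rw [hedef]; linarith
  set tN : ℝ := e - ρ ^ 2 * 1 with htNdef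
  have haδ0 : 2 / 3 < a + δ := by linarith
  have haδsq : (4 : ℝ) / 9 < (a + δ) ^ 2 := by
    have : (2 / 3 : ℝ) ^ 2 < (a + δ) ^ 2 := by gcongr
    linarith
  have haδsq' : (a + δ) ^ 2 < 1 := by
    have : (a + δ) ^ 2 < (9 / 10 : ℝ) ^ 2 := by gcongr
    linarith
  have haδ81 : (a + δ) ^ 2 < (9 / 10 : ℝ) ^ 2 := by gcongr
  have hρ2 : ρ ^ 2 ≤ 1 / 400 := by
    have : ρ ^ 2 ≤ (1 / 20 : ℝ) ^ 2 := by gcongr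
    linarith
  have hs₁sq : -(81 : ℝ) / 400 < s₁ := by linarith
  have hD1 : (23 : ℝ) / 100 < tN + (a + δ) ^ 2 := by
    have htN : tN = e - ρ ^ 2 * 1 := rfl
    rw [htN]; linarith
  have hD0 : 0 ≤ tN + (a + δ) ^ 2 := by linarith
  obtain ⟨N, hN1, hN2⟩ : ∃ N : ℕ, (N : ℝ) ≤ (tN + (a + δ) ^ 2) / L ∧ (tN + (a + δ) ^ 2) / L < N + 1 :=
    ⟨⌊(tN + (a + δ) ^ 2) / L⌋₊, Nat.floor_le (div_nonneg hD0 hL0.le), Nat.lt_floor_add_one _⟩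
  set t₀ : ℝ := tN - N * L with ht₀def
  have hN1' : (N : ℝ) * L ≤ tN + (a + δ) ^ 2 := by rwa [le_div_iff₀ hL0] at hN1
  have hN2' : tN + (a + δ) ^ 2 < (N + 1) * L := by rwa [div_lt_iff₀ hL0] at hN2
  have ht₀1 : -(a + δ) ^ 2 ≤ t₀ := by rw [ht₀def]; linarith
  have ht₀2 : t₀ < -(a + δ) ^ 2 + L := by rw [ht₀def]; linarith
  have hNmax' : N ≤ Nmax := by
    have h1 : (N : ℝ) ≤ 1 / L := by
      refine hN1.trans (div_le_div_of_nonneg_right ?_ hL0.le)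
      have hρsq : 0 ≤ ρ ^ 2 * 1 := by positivity
      rw [htNdef]; linarith
    exact_mod_cast h1.trans hNmax
  -- `N ρ/2 ≥ 1`: the chain reaches the shell radius `a`
  have hNρ : 1 ≤ (N : ℝ) * (ρ / 2) := by
    have h1 : (23 : ℝ) / 100 < (N + 1) * L := hD1.trans hN2'
    rw [hLdef] at h1
    -- (N+1) ρ² > 0.46, ρ ≤ 1/20 ⇒ (N+1) ρ > 9.2 ⇒ N ρ ≥ 9.2 - ρ
    have h2 : (46 : ℝ) / 100 < (N + 1) * ρ * ρ := by linarith
    have h3 : (N + 1 : ℝ) * ρ * ρ ≤ (N + 1) * ρ * (1 / 20) :=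
      mul_le_mul_of_nonneg_left hρ20 (by positivity)
    linarith
  -- ### the centres
  obtain ⟨rad, hraddef⟩ : ∃ rad : ℕ → ℝ, ∀ k, rad k = min a (5 * rstar / 8 + k * (ρ / 2)) := ⟨_, fun k => rfl⟩
  have hrad_lo : ∀ k, 5 * rstar / 8 ≤ rad k := fun k => by
    rw [hraddef k]
    refine le_min ?_ ?_
    · linarith
    · have : (0 : ℝ) ≤ k * (ρ / 2) := by positivity
      linarith
  have hrad_hi : ∀ k, rad k ≤ a := fun k => by rw [hraddef k]; exact min_le_left _ _
  have hrad0 : ∀ k, 0 ≤ rad k := fun k => le_trans (by positivity) (hrad_lo k)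
  have hradN : rad N = a := by
    rw [hraddef N]
    refine min_eq_left ?_
    have := hNρ; linarith [hrstar2]
  obtain ⟨x, hxdef⟩ : ∃ x : ℕ → EuclideanSpace ℝ (Fin 3), ∀ k, x k = cylPt (rad k) 0 z₁ := ⟨_, fun k => rfl⟩
  -- bounds in the balls
  have hball : ∀ k (y : EuclideanSpace ℝ (Fin 3)), dist y (x k) ≤ ρ →
      rstar / 4 < cylRadius y ∧ 0 < cylRadius y ∧ cylRadius y ≤ 1 ∧ cylRadius y < a + δ ∧ cylRadius y < 9 / 10 ∧
        |y 2| < 1 / 2 ∧ rad k - ρ ≤ cylRadius y := by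
    intro k y hy
    rw [hxdef k] at hy
    obtain ⟨h1, h2, h3⟩ := ball_cylPt_bounds (hrad0 k) hy
    have hlo := hrad_lo k
    have hhi := hrad_hi k
    have hq : rstar / 4 < cylRadius y := by linarith
    refine ⟨hq, by linarith, by linarith, by linarith, by linarith, by linarith, h1⟩
  -- ### the comparison function, the drift, the region
  obtain ⟨V, hVdef⟩ : ∃ V : ℝ → EuclideanSpace ℝ (Fin 3) → ℝ, V = fun t y => M - lift Γ t y := ⟨_, rfl⟩
  obtain ⟨b, hbdef⟩ : ∃ b : ℝ → EuclideanSpace ℝ (Fin 3) → EuclideanSpace ℝ (Fin 3), b = fun _ y =>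
    ((2 - Cd) / cylRadius y ^ 2) •
      (y 0 • EuclideanSpace.single (0 : Fin 3) (1 : ℝ) + y 1 • EuclideanSpace.single (1 : Fin 3) (1 : ℝ)) := ⟨_, rfl⟩
  obtain ⟨U, hUdef⟩ : ∃ U : Set (ℝ × EuclideanSpace ℝ (Fin 3)), U = {p | p.1 < 0 ∧ rstar / 4 < cylRadius p.2} :=
    ⟨_, rfl⟩
  have hU : IsOpen U := by rw [hUdef]; exact HarnackChainData.isOpen_offAxisRegion _
  have hVC2 : ContDiffOn ℝ 2 (uncurry V) U := by
    rw [hVdef, hUdef]; exact HarnackChainData.contDiffOn_comparison hC2 M (by positivity)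
  have hbC1 : ContDiffOn ℝ 1 (uncurry b) U := by
    rw [hbdef, hUdef]; exact HarnackChainData.contDiffOn_drift (2 - Cd) (by positivity)
  -- time bookkeeping: cylinder `k ≤ N` lives in `(t₀ + kL, t₀ + kL + ρ²) ⊆ (−(a+δ)², e)`, `e < 0`
  have htk : ∀ k : ℕ, k ≤ N → t₀ + k * (ρ ^ 2 * 1 / 2) + ρ ^ 2 * 1 ≤ e := by
    intro k hk
    have hk' : (k : ℝ) ≤ N := by exact_mod_cast hk
    have : (k : ℝ) * (ρ ^ 2 * 1 / 2) ≤ N * L := by rw [hLdef]; exact mul_le_mul_of_nonneg_right hk' hL0.le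
    rw [ht₀def, htNdef]; linarith
  -- early cylinders (centre radius `< a`) end before `−(a−δ)²`
  have hearly : ∀ k : ℕ, rad k < a → t₀ + k * (ρ ^ 2 * 1 / 2) + ρ ^ 2 * 1 ≤ -(a - δ) ^ 2 := by
    intro k hk
    have hk' : 5 * rstar / 8 + k * (ρ / 2) < a := by
      rw [hraddef k] at hk
      by_contra hcon
      push Not at hcon
      rw [min_eq_left hcon] at hk
      exact lt_irrefl a hk
    have hkρ : (k : ℝ) * (ρ / 2) < a := by linarith [hrstar0]
    have h1 : (k : ℝ) * (ρ ^ 2 * 1 / 2) = k * (ρ / 2) * ρ := by ring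
    have h2 : (k : ℝ) * (ρ / 2) * ρ ≤ a * ρ := mul_le_mul_of_nonneg_right hkρ.le hρ0.le
    -- `L + aρ + ρ² ≤ δ/2 ≤ 4aδ`
    have hρρ : ρ ^ 2 ≤ ρ * (1 / 20) := by rw [sq]; exact mul_le_mul_of_nonneg_left hρ20 hρ0.le
    have haρ : a * ρ ≤ (4 / 5) * ρ := mul_le_mul_of_nonneg_right ha2.le hρ0.le
    have h3 : L + a * ρ + ρ ^ 2 * 1 ≤ δ / 2 := by
      rw [hLdef]; linarith
    have h4' : (a + δ) ^ 2 - (a - δ) ^ 2 = 4 * a * δ := by ring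
    have haδ' : (2 / 3) * δ ≤ a * δ := mul_le_mul_of_nonneg_right ha1.le hδ0.le
    have h4 : δ / 2 ≤ (a + δ) ^ 2 - (a - δ) ^ 2 := by rw [h4']; linarith
    rw [h1]; linarith
  -- ### run the chain
  have hmain := hchain V b U x t₀ ρ (κ₀ / 2) N hρ0 (by positivity) hU hVC2 hbC1 ?_ ?_ ?_ ?_ N le_rfl s₁ ?_ (x N)
    (mem_ball_self (by positivity))
  · -- ### conclusion
    have hV : V s₁ (x N) = M - Γ a z₁ s₁ := by
      rw [hVdef, hxdef N]
      simp only [lift]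
      rw [ShellBookkeeping.cylRadius_cylPt (hrad0 N), cylPt_apply_two, hradN]
    rw [hV] at hmain
    have hmon : Γ r₁ z₁ s₁ ≤ Γ a z₁ s₁ := (hmono s₁ hs₁0 z₁ r₁ a hr₁.le (by linarith)).2
    have hpow : β ^ (Nmax + 1) ≤ β ^ (N + 1) := pow_le_pow_of_le_one hβ.le hβ1 (by omega)
    have hpow' : β ^ (Nmax + 1) * (κ₀ / 2) ≤ β ^ (N + 1) * (κ₀ / 2) :=
      mul_le_mul_of_nonneg_right hpow (by positivity)
    linarith
  · -- consecutive centres are `≤ ρ/2` apart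
    intro k _
    rw [hxdef (k + 1), hxdef k, dist_cylPt_ray, hraddef (k + 1), hraddef k]
    have h := abs_min_sub_min_le_max a (5 * rstar / 8 + (k + 1 : ℕ) * (ρ / 2)) a (5 * rstar / 8 + k * (ρ / 2))
    rw [sub_self, abs_zero] at h
    refine h.trans (max_le (by positivity) (le_of_eq ?_))
    push_cast
    rw [show 5 * rstar / 8 + (k + 1 : ℝ) * (ρ / 2) - (5 * rstar / 8 + k * (ρ / 2)) = ρ / 2 by ring,
      abs_of_pos (by positivity)]
  · -- the closed cylinders lie in `U`
    intro k hk p hp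
    obtain ⟨hp1, hp2⟩ := hp
    rw [hUdef]
    refine ⟨?_, ?_⟩
    · exact lt_of_le_of_lt (hp1.2.trans (htk k hk)) he2
    · exact (hball k p.2 (mem_closedBall.1 hp2)).1
  · -- the cylinder data: drift bound, divergence, `V ≥ 0`, supersolution
    intro k hk t ht y hy
    have hy' : dist y (x k) ≤ ρ := (mem_ball.1 hy).le
    obtain ⟨hq, hy0, hy1, hyaδ, hy9, hy2, hylo⟩ := hball k y hy'
    have hyne : cylRadius y ≠ 0 := hy0.ne'
    have ht0 : t < 0 := lt_of_lt_of_le ht.2 ((htk k hk).trans he2.le)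
    have ht1 : -(a + δ) ^ 2 < t := by
      have : t₀ ≤ t₀ + k * (ρ ^ 2 * 1 / 2) := by
        have : (0 : ℝ) ≤ k * (ρ ^ 2 * 1 / 2) := by positivity
        linarith
      linarith [ht.1]
    refine ⟨?_, ?_, ?_, ?_⟩
    · -- drift bound `‖b‖ ≤ |2 - Cd| / (rstar/4) = Λ/ρ`
      have h := RadialDrift.norm_radialDrift_le (2 - Cd) (by positivity : 0 < rstar / 4) hq
      have hΛρ : Λ / ρ = |2 - Cd| / (rstar / 4) := by
        rw [hΛdef]; field_simp
      rw [hΛρ]; simp only [hbdef]; exact h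
    · simp only [hbdef]; exact RadialDrift.divergence_radialDrift (2 - Cd) hyne
    · -- `V ≥ 0` from `Γ ≤ M` on `𝒬(9/10)`
      have hΓM := hbound t (cylRadius y) (y 2) (by linarith) ht0 hy0 hy9 (by linarith)
      simp only [hVdef, lift]; linarith
    · -- supersolution: eq. Gamma-34 holds at `(t, |y_h|, y₃)` (early slab or lateral shell)
      have hdisj : a - δ < cylRadius y ∨ t < -(a - δ) ^ 2 := by
        by_cases hka : rad k < a
        · right
          exact lt_of_lt_of_le ht.2 (hearly k hka)
        · left
          have hka' : rad k = a := le_antisymm (hrad_hi k) (not_lt.1 hka)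
          have : ρ < δ := by linarith
          linarith
      have hg := h34 t (cylRadius y) (y 2) ht1 ht0 hy0 hyaδ (by linarith) hdisj
      simp only [hVdef, hbdef]
      exact HarnackChainData.supersolution_comparison hC2 hmono hCd M ht0 hy0 hy1 hg
  · -- the initial positivity on the first ball: `Γ ≤ 2A r ≤ κ₀/2` at the early time `t₀ + ρ²/4`
    intro y hy
    have hy' : dist y (x 0) ≤ ρ := (mem_ball.1 hy).le
    obtain ⟨hq, hy0, hy1, hyaδ, hy9, hy2, hylo⟩ := hball 0 y hy'
    rw [hxdef 0] at hy'
    obtain ⟨-, hyhi, -⟩ := ball_cylPt_bounds (hrad0 0) hy'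
    have hrad0' : rad 0 ≤ 5 * rstar / 8 := by
      rw [hraddef 0]
      simp only [Nat.cast_zero, zero_mul, add_zero]
      exact min_le_right _ _
    have hyr : cylRadius y ≤ rstar := by linarith
    -- the time `t₀ + ρ²/4` is early: `−s ≥ (a−δ)² > 1/4`
    have hs0 : t₀ + ρ ^ 2 * 1 / 4 < 0 := by linarith
    have hs1 : (1 : ℝ) / 4 ≤ -(t₀ + ρ ^ 2 * 1 / 4) := by
      have h1 : t₀ + ρ ^ 2 * 1 / 4 ≤ -(a + δ) ^ 2 + L + ρ ^ 2 * 1 / 4 := by linarith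
      have hρρ : ρ ^ 2 ≤ ρ * (1 / 20) := by rw [sq]; exact mul_le_mul_of_nonneg_left hρ20 hρ0.le
      have h4' : (a + δ) ^ 2 - (a - δ) ^ 2 = 4 * a * δ := by ring
      have haδ' : (2 / 3) * δ ≤ a * δ := mul_le_mul_of_nonneg_right ha1.le hδ0.le
      have h2 : L + ρ ^ 2 * 1 / 4 ≤ (a + δ) ^ 2 - (a - δ) ^ 2 := by rw [hLdef, h4']; linarith
      have h3' : (1 / 2 : ℝ) ^ 2 < (a - δ) ^ 2 := by gcongr; linarith
      have h3 : (1 : ℝ) / 4 < (a - δ) ^ 2 := by linarith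
      linarith
    have hsq : (1 : ℝ) / 2 ≤ Real.sqrt (-(t₀ + ρ ^ 2 * 1 / 4)) := by
      rw [show (1 : ℝ) / 2 = Real.sqrt (1 / 4) by
        rw [show (1 : ℝ) / 4 = (1 / 2) ^ 2 by norm_num, Real.sqrt_sq (by norm_num)]]
      exact Real.sqrt_le_sqrt hs1
    have hΓ := hsmall (t₀ + ρ ^ 2 * 1 / 4) hs0 (cylRadius y) hy0.le (y 2)
    have hdiv : A * cylRadius y / Real.sqrt (-(t₀ + ρ ^ 2 * 1 / 4)) ≤ A * cylRadius y / (1 / 2) :=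
      div_le_div_of_nonneg_left (by positivity) (by norm_num) hsq
    have hfin : A * cylRadius y / (1 / 2) ≤ κ₀ / 2 := by
      rw [div_eq_mul_inv, show ((1 : ℝ) / 2)⁻¹ = 2 by norm_num]
      have := mul_le_mul_of_nonneg_left hyr hA
      linarith
    simp only [hVdef, lift]
    linarith
  · -- the target time lies in the last conclusion window
    constructor
    · rw [ht₀def, htNdef, hLdef]; linarith
    · rw [ht₀def, htNdef, hLdef]; linarith

/-- **STUB (5b-ii) of the line `lrt_shell` v6 — the pure-PDE Harnack chain, registered text `AxisHarnackChain`
(brick F4 `…UnitContraction`).** From the classical closed-cylinder positivity propagation via its affine form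
(`positivityPropagationAffine_of_factC`, brick H2). [cite: LeiRenTian2025, §4 (arXiv:2501.08976, pp. 11–12)] -/
theorem axisHarnackChain : AxisHarnackChain := fun hC =>
  axisHarnackChain_of_affine (positivityPropagationAffine_of_factC hC)

end Summit.NavierStokesRegularity.NavierStokesRegularity.Theorems.AveragedConeLiouville.HarnackChain

end
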